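import Summits.ValiantsHypothesis.ValiantsHypothesis.Theorems.BarrierLeverPartitionMinorsHitByVPJointPeelClass
import Summits.ValiantsHypothesis.ValiantsHypothesis.Theorems.BarrierLeverPartitionMinorsHitByVPJointPeel

/-!
# Route BarrierLever — item `PartitionMinorsHitByVP` (stmt-ValiantsHypothesis-19717):
# JOINTLY PEELABLE layouts are hit

Helper file (`--supports stmt-ValiantsHypothesis-19717`; cell valiant-natproofs, rung V4, 𝒟-side door (c); prover
seat val-np-p6 gen 6). Definition-free. Closes NO item.

* `colMatrix_det_ne_zero_of_jointlyPeelable` — a `JointlyPeelable` certificate (`…JointPeelClass`) for (rows `R`, column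
  data `W`) makes the Moore matrix `colMatrix p n k d R W` nonsingular in `𝔽_p[Y]` (induction over the certificate, each
  constructor being one lemma of the toolkit `…JointPeel`).
* **`partitionMinor_hit_of_jointlyPeelable`** — item level: for `h ≥ 2`, injective `u, w : Fin r → Finset (Fin h)` and
  a certificate for the pair (range of `u` as a set family, columns `w` transported along `u`), the layout `(u, w)` is hit
  inside `SmallCircuits ℂ (h+h) 5` (characteristic-`2` Frobenius door; any prime would do).

WHAT THIS IS NOT: which pairs admit a certificate is a combinatorial question (seat census: ≈ half of the lower-set pairs
at `h ≤ 5`); T1 / F_3 for arbitrary pairs stay OPEN; nothing on crux 14610 or VP vs VNP.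
-/

set_option linter.dupNamespace false

namespace Summit.ValiantsHypothesis.ValiantsHypothesis.Theorems.BarrierLever.FrobeniusDoor

open Finset MvPolynomial Matrix
open Literature.Barriers.ValiantsHypothesis

noncomputable section

variable (p : ℕ) [Fact p.Prime]

/-- **A jointly peelable pair has a nonsingular Moore matrix** (every prime `p`). -/
theorem colMatrix_det_ne_zero_of_jointlyPeelable {k : ℕ} {d : Fin k → ℕ} {n : ℕ}
    {R : Finset (Finset (Fin n))} {W : Fam R → Finset (Fin k)} (hJ : JointlyPeelable k d n R W) :
    (colMatrix p n k d R W).det ≠ 0 := by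
  induction hJ with
  | small hR => exact colMatrix_det_ne_zero_of_card_le_one p _ _ _ _ _ hR
  | peel hR c₀ hmin κ₀ κ₁ _ _ ihdel ihlink =>
      exact colMatrix_det_ne_zero_peel p _ _ _ _ hR _ c₀ hmin κ₀ κ₁ ihdel ihlink
  | relabel π e he _ ih => exact colMatrix_det_ne_zero_relabel p _ _ _ _ _ π e he ih

/-- **JOINTLY PEELABLE LAYOUTS ARE HIT.** `h ≥ 2`; `u, w : Fin r → Finset (Fin h)` injective; `σ : Fin r ≃ Fam R` an
enumeration of the row family `R` by `u` (`(σ i).1 = u i`); if the pair (`R`, columns `T ↦ w (σ⁻¹ T)`) is jointly peelable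
for the item's digit exponents `d = id`, the partition minor of `(u, w)` is nonsingular at some `f ∈ SmallCircuits ℂ (h+h) 5`. -/
theorem partitionMinor_hit_of_jointlyPeelable {h r : ℕ} (hh : 2 ≤ h) (u w : Fin r → Finset (Fin h))
    (R : Finset (Finset (Fin h))) (σ : Fin r ≃ Fam R) (hσ : ∀ i, (σ i).1 = u i)
    (hJ : JointlyPeelable h (fun c : Fin h => (c : ℕ)) h R (fun T => w (σ.symm T))) :
    ∃ f ∈ SmallCircuits ℂ (h + h) 5,
      (Matrix.of fun i j : Fin r => MvPolynomial.coeff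
        (∑ a ∈ u i, Finsupp.single (Fin.castAdd h a) 1 +
          ∑ c ∈ w j, Finsupp.single (Fin.natAdd h c) 1) f).det ≠ 0 := by
  classical
  haveI : Fact (Nat.Prime 2) := ⟨Nat.prime_two⟩
  have hC := colMatrix_det_ne_zero_of_jointlyPeelable 2 hJ
  -- transport to the tree's variables `Option (Fin h)` and the enumeration `Fin r`
  set ρ : MvPolynomial (Fin (h + 1)) (ZMod 2) →ₐ[ZMod 2] MvPolynomial (Option (Fin h)) (ZMod 2) :=
    rename (finSuccEquivLast : Fin (h + 1) ≃ Option (Fin h)) with hρ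
  set N : Matrix (Fin r) (Fin r) (MvPolynomial (Option (Fin h)) (ZMod 2)) :=
    Matrix.of fun i j : Fin r =>
      ((X none + ∑ a ∈ u i, X (some a) : MvPolynomial (Option (Fin h)) (ZMod 2))) ^ (∑ c ∈ w j, 2 ^ (c : ℕ)) with hN
  have hmat : (ρ.mapMatrix (colMatrix 2 h h (fun c : Fin h => (c : ℕ)) R (fun T => w (σ.symm T)))).submatrix σ σ = N := by
    refine Matrix.ext fun i j => ?_
    simp only [Matrix.submatrix_apply, AlgHom.mapMatrix_apply, Matrix.map_apply, colMatrix, hN, Matrix.of_apply, map_pow,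
      ballEta, ballWt, map_add, map_sum, hρ, rename_X, finSuccEquivLast_last, finSuccEquivLast_castSucc, hσ,
      Equiv.symm_apply_apply]
  have hN0 : N.det ≠ 0 := by
    intro h0
    apply hC
    apply MvPolynomial.rename_injective _ (finSuccEquivLast : Fin (h + 1) ≃ Option (Fin h)).injective
    have := ρ.map_det (colMatrix 2 h h (fun c : Fin h => (c : ℕ)) R (fun T => w (σ.symm T)))
    rw [← Matrix.det_submatrix_equiv_self σ (ρ.mapMatrix (colMatrix 2 h h (fun c : Fin h => (c : ℕ)) R
      (fun T => w (σ.symm T)))), hmat, h0] at this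
    rw [map_zero, ← hρ]
    exact this
  exact partitionMinor_hit_of_frobenius_char 2 hh u w hN0

end

end Summit.ValiantsHypothesis.ValiantsHypothesis.Theorems.BarrierLever.FrobeniusDoor
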